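import Mathlib
import HarnessLib
import Literature.Probability.MarkovChains.LogSobolevProductChains
import Literature.Probability.MarkovChains.IsingSpectralHighTemperatureLSI

/-!
# A uniform logarithmic Sobolev inequality for the ASYMMETRIC two-point space and for product
# Bernoulli measures with the single-spin-flip Dirichlet form (Bauerschmidt–Bodineau–Dagallier 2024,
# Prop. 15 + tensorisation; Diaconis–Saloff-Coste 1996) — PROVED

Conventions of `PeskunOrdering.lean` (`dirichletForm π K f = ½ Σ_{x,y} π(x)K(x,y)(f x − f y)²`),
`LogSobolevConstant.lean` (`entForm π f = Σ π f² log(f²/‖f‖²_π)`), `ProductChains.lean` (`tensorFun`,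
`prodKernel`) and `IsingSpectralHighTemperatureLSI.lean` (`SpectralIsing.flip`, `flipKernel`, `ent`).
Companion of `LogSobolevTwoPoint.lean`, which proves the SYMMETRIC case `θ = ½` (Bonami–Gross,
Saloff-Coste Thm 2.2.8 at `θ = ½`).

What is printed.  R. Bauerschmidt, T. Bodineau, B. Dagallier, *Stochastic dynamics and the Polchinski
equation: an introduction*, Probab. Surveys 21 (2024) [BBD], §6.4.2 **Proposition 15** (p0038): "Let `μ` be
the probability measure on `{±1}` with `μ(+1) = p = 1 − q`.  Then
`Ent_μ(F) ≤ [pq(log p − log q)/(p − q)] (√F(+1) − √F(−1))²`.  Thus the log-Sobolev constant with respect to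
the standard Dirichlet form on `{±1}` [`D_μ(F) = ½(F(+1) − F(−1))²`] is at least `2`:
`Ent_μ(F) ≤ D(√F) = (2/γ₀)D(√F)`, `γ₀ = 2`" (proof referred to Saloff-Coste's Saint-Flour notes
[MR1490046] = Thm 2.2.8 / Diaconis–Saloff-Coste, Ann. Appl. Probab. 6 (1996) Thm A.2, and to Ané et al.
[MR1845806]); and §6.4.3 p0039 L17–25: "Since `μ_0^φ` is a product measure … one can take `γ₀ = 2` for the
standard Dirichlet form" (tensorisation, [BBD] Example (example: tensorisation)).

What is here (all PROVED, 0 definitions, 0 named facts):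
* `twoPointAsym_aux` — the one-variable inequality behind the UNIFORM bound
  `p x² log x² − (px² + q) log(px² + q) ≤ (x − 1)²/2` (`0 < p < 1`, `q = 1 − p`, `x ≥ 0`): with `ψ` the
  difference, `ψ(1) = ψ′(1) = 0` and `ψ″ = 1 − 4p + 2p log s + 4p²/s ≥ 1 − 2p + 2p log(2p) ≥ 0`
  (`s = (px² + q)/x²`; twice `log u ≥ 1 − 1/u`), then two monotonicity passes;
* `twoPointAsym_entropy_le` — **the uniform asymmetric two-point inequality**
  `p a² log a² + q b² log b² − (pa² + qb²) log(pa² + qb²) ≤ (a − b)²/2` for ALL real `a, b` and every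
  `p ∈ (0,1)` — i.e. Prop. 15's consequence "`Ent_μ(F) ≤ D(√F)`" (the sharp constant
  `pq(log p − log q)/(p − q) ≤ ½` is not needed and not formalised);
* `entForm_le_dirichletForm_twoPoint` — the same in the tree's vocabulary: for every positive probability
  vector `π` on `ℤˣ = {±1}` and every `g`, `𝓛_π(g) ≤ 𝓔_π(K_flip; g)` with the flip kernel
  `K_flip(u,v) = 1{v = −u}` (log-Sobolev constant `α ≥ 1` in Saloff-Coste's normalisation, for every `p`);
* `prodKernel_one_flip_eq_flipKernel` — on `{±1}^d` (`d` sites, `Fin d`), the product chain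
  `Σ_j K̃_flip,j` of Levin–Peres–Wilmer (12.22) with unit weights IS `SpectralIsing.flipKernel`;
* `ent_eq_entForm_sqrt` — `Ent_π(F) = 𝓛_π(√F)` for `F ≥ 0`;
* **`SpectralIsing.ent_tensorFun_le_dirichletForm_flipKernel`** — for every product of positive
  probability vectors `π_j` on `{±1}` (`j < d`) and every `F ≥ 0` on `{±1}^d`,
  `Ent_{⊗π_j}(F) ≤ D_{⊗π_j}(√F) = ½ Σ_x E[(√F(σ) − √F(σ^x))²]` — the infinite-temperature (product) Ising
  log-Sobolev inequality with `γ₀ = 2`, UNIFORM in the fields, by the tree's tensorisation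
  `logSobolev_prodKernel_of_forall` (Saloff-Coste Lemma 2.2.11).
This is the "first term" input of [BBD] (e:ent-decomp-Ising) in the proof of the spectral
high-temperature LSI ([BBD] Thm 10 = Bauerschmidt–Bodineau 2019), typed in the tree as the named fact
`SpectralIsing.BauerschmidtBodineau2019_logSobolev`.

## References
* [BauerschmidtBodineauDagallier2023] R. Bauerschmidt, T. Bodineau, B. Dagallier, Probab. Surveys 21 (2024)
  = arXiv:2307.07619: §6.4.2 Prop. 15 (p0038), §6.4.3 (p0039 L17–25). READ (held text).
* [Saloffcoste1997] L. Saloff-Coste, *Lectures on finite Markov chains*, LNM 1665 (1997): §2.2.2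
  Thm 2.2.8, §2.2.3 Lemma 2.2.11.
* [DiaconisSaloffcoste1996] P. Diaconis, L. Saloff-Coste, *Logarithmic Sobolev inequalities for finite
  Markov chains*, Ann. Appl. Probab. 6 (1996) 695–750, Thm A.2.
-/

namespace Literature.Probability.MarkovChains

open Finset Matrix

/-! ## The one-variable inequality -/

/-- `p x² log x² − (px² + q) log(px² + q) ≤ (x − 1)²/2` for `0 < p < 1`, `q = 1 − p`, `x ≥ 0`.  With `ψ`
the difference `RHS − LHS`: `ψ(1) = 0`, `ψ′(x) = (x − 1) − 2px log x² + 2px log(px² + q)` vanishes at `1`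
and is non-decreasing on `(0,∞)` because `ψ″(x) = 1 − 4p + 2p log s + 4p²/s` (`s = (px² + q)/x²`) is
`≥ 1 − 2p + 2p log(2p) ≥ 0` (both steps are `log u ≥ 1 − 1/u`).
[cite: BauerschmidtBodineauDagallier2023, §6.4.2 Prop. 15] -/
theorem twoPointAsym_aux {p : ℝ} (hp0 : 0 < p) (hp1 : p < 1) {x : ℝ} (hx : 0 ≤ x) :
    p * (x ^ 2 * Real.log (x ^ 2)) - (p * x ^ 2 + (1 - p)) * Real.log (p * x ^ 2 + (1 - p))
      ≤ (x - 1) ^ 2 / 2 := by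
  set q : ℝ := 1 - p with hq
  have hq0 : 0 < q := by rw [hq]; linarith
  -- `N(x) = p x² + q > 0`
  have hN : ∀ u : ℝ, 0 < p * u ^ 2 + q := fun u => by positivity
  set ψ : ℝ → ℝ := fun u => (u - 1) ^ 2 / 2 - p * (u ^ 2 * Real.log (u ^ 2))
    + (p * u ^ 2 + q) * Real.log (p * u ^ 2 + q) with hψ
  set ψ₁ : ℝ → ℝ := fun u => (u - 1) - 2 * p * u * Real.log (u ^ 2)
    + 2 * p * u * Real.log (p * u ^ 2 + q) with hψ₁
  set ψ₂ : ℝ → ℝ := fun u => 1 - 4 * p - 2 * p * Real.log (u ^ 2) + 2 * p * Real.log (p * u ^ 2 + q)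
    + 4 * p ^ 2 * u ^ 2 / (p * u ^ 2 + q) with hψ₂
  -- derivative of `N`
  have hdN : ∀ u : ℝ, HasDerivAt (fun u : ℝ => p * u ^ 2 + q) (2 * p * u) u := by
    intro u
    have h := (((hasDerivAt_id u).pow 2).const_mul p).add_const q
    refine h.congr_deriv ?_
    simp only [id, Nat.cast_ofNat]
    ring
  -- `ψ' = ψ₁` on `u ≠ 0`
  have hdψ : ∀ u : ℝ, u ≠ 0 → HasDerivAt ψ (ψ₁ u) u := by
    intro u hu
    have hu2 : u ^ 2 ≠ 0 := pow_ne_zero 2 hu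
    have h1 : HasDerivAt (fun u : ℝ => (u - 1) ^ 2 / 2) ((2 : ℕ) * (u - 1) ^ (2 - 1) * 1 / 2) u :=
      (((hasDerivAt_id u).sub_const 1).pow 2).div_const 2
    have hsq : HasDerivAt (fun u : ℝ => u ^ 2) ((2 : ℕ) * u ^ (2 - 1) * 1) u := (hasDerivAt_id u).pow 2
    have h2 : HasDerivAt (fun u : ℝ => u ^ 2 * Real.log (u ^ 2))
        (((2 : ℕ) * u ^ (2 - 1) * 1) * Real.log (u ^ 2) + u ^ 2 * (((2 : ℕ) * u ^ (2 - 1) * 1) / u ^ 2)) u :=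
      hsq.mul (hsq.log hu2)
    have h3 : HasDerivAt (fun u : ℝ => (p * u ^ 2 + q) * Real.log (p * u ^ 2 + q))
        ((2 * p * u) * Real.log (p * u ^ 2 + q) + (p * u ^ 2 + q) * ((2 * p * u) / (p * u ^ 2 + q))) u :=
      (hdN u).mul ((hdN u).log (hN u).ne')
    have h := (h1.sub (h2.const_mul p)).add h3
    refine h.congr_deriv ?_
    rw [hψ₁]
    simp only [Nat.cast_ofNat]
    field_simp
    ring
  -- `ψ₁' = ψ₂` on `u ≠ 0`
  have hdψ₁ : ∀ u : ℝ, u ≠ 0 → HasDerivAt ψ₁ (ψ₂ u) u := by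
    intro u hu
    have hu2 : u ^ 2 ≠ 0 := pow_ne_zero 2 hu
    have h1 : HasDerivAt (fun u : ℝ => u - 1) 1 u := (hasDerivAt_id u).sub_const 1
    have hsq : HasDerivAt (fun u : ℝ => u ^ 2) ((2 : ℕ) * u ^ (2 - 1) * 1) u := (hasDerivAt_id u).pow 2
    have hlin : HasDerivAt (fun u : ℝ => 2 * p * u) (2 * p * 1) u := (hasDerivAt_id u).const_mul (2 * p)
    have h2 : HasDerivAt (fun u : ℝ => 2 * p * u * Real.log (u ^ 2))
        ((2 * p * 1) * Real.log (u ^ 2) + (2 * p * u) * (((2 : ℕ) * u ^ (2 - 1) * 1) / u ^ 2)) u :=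
      hlin.mul (hsq.log hu2)
    have h3 : HasDerivAt (fun u : ℝ => 2 * p * u * Real.log (p * u ^ 2 + q))
        ((2 * p * 1) * Real.log (p * u ^ 2 + q) + (2 * p * u) * ((2 * p * u) / (p * u ^ 2 + q))) u :=
      hlin.mul ((hdN u).log (hN u).ne')
    have h := (h1.sub h2).add h3
    refine h.congr_deriv ?_
    rw [hψ₂]
    simp only [Nat.cast_ofNat]
    field_simp
    ring
  -- `ψ₂ ≥ 0` on `u > 0`
  have hψ₂nn : ∀ u : ℝ, 0 < u → 0 ≤ ψ₂ u := by
    intro u hu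
    have hu2 : 0 < u ^ 2 := by positivity
    set s : ℝ := (p * u ^ 2 + q) / u ^ 2 with hs
    have hs0 : 0 < s := div_pos (hN u) hu2
    have hlog : Real.log (p * u ^ 2 + q) - Real.log (u ^ 2) = Real.log s := by
      rw [hs, Real.log_div (hN u).ne' hu2.ne']
    have hfrac : 4 * p ^ 2 * u ^ 2 / (p * u ^ 2 + q) = 4 * p ^ 2 / s := by
      rw [hs]; field_simp
    have e : ψ₂ u = 1 - 4 * p + 2 * p * Real.log s + 4 * p ^ 2 / s := by
      rw [hψ₂]; dsimp only; rw [hfrac, ← hlog]; ring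
    rw [e]
    -- `log s ≥ log (2p) + 1 − 2p/s`
    have h2p : 0 < 2 * p := by positivity
    have hl1 : Real.log (2 * p) + 1 - 2 * p / s ≤ Real.log s := by
      have h := Real.one_sub_inv_le_log_of_pos (div_pos hs0 h2p)
      rw [Real.log_div hs0.ne' h2p.ne', inv_div] at h
      linarith
    -- `2p log(2p) ≥ 2p − 1`
    have hl2 : 2 * p - 1 ≤ 2 * p * Real.log (2 * p) := by
      have h := Real.one_sub_inv_le_log_of_pos h2p
      have h' := mul_le_mul_of_nonneg_left h h2p.le
      rw [mul_sub, mul_one, mul_inv_cancel₀ h2p.ne'] at h'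
      linarith
    have hkey : 2 * p * (Real.log (2 * p) + 1 - 2 * p / s) ≤ 2 * p * Real.log s :=
      mul_le_mul_of_nonneg_left hl1 h2p.le
    have e2 : 2 * p * (Real.log (2 * p) + 1 - 2 * p / s) + 4 * p ^ 2 / s
        = 2 * p * Real.log (2 * p) + 2 * p := by
      field_simp; ring
    nlinarith [hkey, hl2, e2]
  -- `ψ₁` is non-decreasing on `(0, ∞)` and vanishes at `1`
  have hψ₁1 : ψ₁ 1 = 0 := by
    rw [hψ₁]; simp only [one_pow, mul_one, Real.log_one, mul_zero, sub_zero]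
    rw [show p + q = 1 by rw [hq]; ring, Real.log_one, mul_zero]; ring
  have hmono₁ : MonotoneOn ψ₁ (Set.Ioi 0) := by
    refine monotoneOn_of_deriv_nonneg (convex_Ioi 0)
      (fun u hu => (hdψ₁ u (ne_of_gt hu)).continuousAt.continuousWithinAt) ?_ ?_
    · rw [interior_Ioi]
      exact fun u hu => (hdψ₁ u (ne_of_gt hu)).differentiableAt.differentiableWithinAt
    · rw [interior_Ioi]
      intro u hu
      rw [(hdψ₁ u (ne_of_gt hu)).deriv]
      exact hψ₂nn u hu
  -- `ψ` is continuous, non-increasing on `[0,1]`, non-decreasing on `[1,∞)`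
  have hψc : Continuous ψ := by
    rw [hψ]
    refine ((((continuous_id.sub continuous_const).pow 2).div_const 2).sub
      ((Real.continuous_mul_log.comp (continuous_id.pow 2)).const_mul p)).add ?_
    have hNc : Continuous fun u : ℝ => p * u ^ 2 + q := (continuous_const.mul (continuous_id.pow 2)).add
      continuous_const
    exact Real.continuous_mul_log.comp hNc
  have hanti : AntitoneOn ψ (Set.Icc 0 1) := by
    refine antitoneOn_of_deriv_nonpos (convex_Icc 0 1) hψc.continuousOn ?_ ?_
    · rw [interior_Icc]
      exact fun u hu => (hdψ u (ne_of_gt hu.1)).differentiableAt.differentiableWithinAt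
    · rw [interior_Icc]
      intro u hu
      rw [(hdψ u (ne_of_gt hu.1)).deriv, ← hψ₁1]
      exact hmono₁ (Set.mem_Ioi.2 hu.1) (Set.mem_Ioi.2 one_pos) hu.2.le
  have hmono : MonotoneOn ψ (Set.Ici 1) := by
    refine monotoneOn_of_deriv_nonneg (convex_Ici 1) hψc.continuousOn ?_ ?_
    · rw [interior_Ici]
      exact fun u hu => (hdψ u (ne_of_gt (one_pos.trans hu))).differentiableAt.differentiableWithinAt
    · rw [interior_Ici]
      intro u hu
      have hu0 : 0 < u := one_pos.trans hu
      rw [(hdψ u (ne_of_gt hu0)).deriv, ← hψ₁1]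
      exact hmono₁ (Set.mem_Ioi.2 one_pos) (Set.mem_Ioi.2 hu0) (le_of_lt hu)
  have hψ1 : ψ 1 = 0 := by
    rw [hψ]; simp only [sub_self, one_pow, mul_one, Real.log_one, mul_zero]
    rw [show p + q = 1 by rw [hq]; ring, Real.log_one, mul_zero]; ring
  have hψx : 0 ≤ ψ x := by
    rcases le_total x 1 with hx1 | hx1
    · rw [← hψ1]; exact hanti ⟨hx, hx1⟩ ⟨zero_le_one, le_rfl⟩ hx1
    · rw [← hψ1]; exact hmono (Set.mem_Ici.2 le_rfl) (Set.mem_Ici.2 hx1) hx1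
  rw [hψ] at hψx
  dsimp only at hψx
  linarith

/-! ## The uniform asymmetric two-point inequality -/

/-- Homogeneity: for `b > 0`, `x ≥ 0`, the two-point entropy of `((xb)², b²)` is `b²` times that of
`(x², 1)`. [cite: BauerschmidtBodineauDagallier2023, §6.4.2 Prop. 15] -/
private theorem twoPointAsym_scale {p : ℝ} (hp0 : 0 < p) (hp1 : p < 1) {x b : ℝ} (hx : 0 ≤ x)
    (hb : 0 < b) :
    p * ((x * b) ^ 2 * Real.log ((x * b) ^ 2)) + (1 - p) * (b ^ 2 * Real.log (b ^ 2))
        - (p * (x * b) ^ 2 + (1 - p) * b ^ 2) * Real.log (p * (x * b) ^ 2 + (1 - p) * b ^ 2)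
      = b ^ 2 * (p * (x ^ 2 * Real.log (x ^ 2)) - (p * x ^ 2 + (1 - p)) * Real.log (p * x ^ 2 + (1 - p)))
        - b ^ 2 * Real.log (b ^ 2) * 0 := by
  have hb2 : 0 < b ^ 2 := by positivity
  have hq0 : (1 - p) ≠ 0 := by linarith
  have hN0 : p * x ^ 2 + (1 - p) ≠ 0 := by positivity
  have e2 : p * (x * b) ^ 2 + (1 - p) * b ^ 2 = (p * x ^ 2 + (1 - p)) * b ^ 2 := by ring
  rw [e2, Real.log_mul hN0 hb2.ne']
  rcases hx.eq_or_lt with hx0 | hxpos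
  · rw [← hx0]
    simp only [zero_mul, ne_eq, OfNat.ofNat_ne_zero, not_false_eq_true, zero_pow, Real.log_zero,
      mul_zero, zero_add, zero_sub]
    ring
  · have hx2 : 0 < x ^ 2 := by positivity
    have e1 : (x * b) ^ 2 = x ^ 2 * b ^ 2 := by ring
    rw [e1, Real.log_mul hx2.ne' hb2.ne']
    ring

/-- **The uniform asymmetric two-point log-Sobolev inequality** ([BBD] Prop. 15, in the weaker uniform
form "`Ent_μ(F) ≤ D(√F)`, `γ₀ = 2`"): for every `p ∈ (0,1)`, `q = 1 − p`, and all real `a, b`,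
`p a² log a² + q b² log b² − (pa² + qb²) log(pa² + qb²) ≤ (a − b)²/2`.
[cite: BauerschmidtBodineauDagallier2023, §6.4.2 Prop. 15] -/
theorem twoPointAsym_entropy_le {p : ℝ} (hp0 : 0 < p) (hp1 : p < 1) (a b : ℝ) :
    p * (a ^ 2 * Real.log (a ^ 2)) + (1 - p) * (b ^ 2 * Real.log (b ^ 2))
        - (p * a ^ 2 + (1 - p) * b ^ 2) * Real.log (p * a ^ 2 + (1 - p) * b ^ 2)
      ≤ (a - b) ^ 2 / 2 := by
  -- the case `a ≥ 0`, `b > 0`, for an arbitrary weight `p' ∈ (0,1)`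
  have key : ∀ p' : ℝ, 0 < p' → p' < 1 → ∀ a b : ℝ, 0 ≤ a → 0 < b →
      p' * (a ^ 2 * Real.log (a ^ 2)) + (1 - p') * (b ^ 2 * Real.log (b ^ 2))
        - (p' * a ^ 2 + (1 - p') * b ^ 2) * Real.log (p' * a ^ 2 + (1 - p') * b ^ 2)
      ≤ (a - b) ^ 2 / 2 := by
    intro p' hp0' hp1' a b ha hb
    have hx : 0 ≤ a / b := div_nonneg ha hb.le
    have h := twoPointAsym_scale hp0' hp1' hx hb
    rw [div_mul_cancel₀ a hb.ne'] at h
    rw [h, mul_zero, sub_zero]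
    have h2 := mul_le_mul_of_nonneg_left (twoPointAsym_aux hp0' hp1' hx) (sq_nonneg b)
    refine h2.trans (le_of_eq ?_)
    have e : b * (a / b - 1) = a - b := by field_simp
    calc b ^ 2 * ((a / b - 1) ^ 2 / 2) = (b * (a / b - 1)) ^ 2 / 2 := by ring
      _ = (a - b) ^ 2 / 2 := by rw [e]
  -- reduce to `|a|, |b|`
  have habs : ∀ a b : ℝ, 0 ≤ a → 0 ≤ b →
      p * (a ^ 2 * Real.log (a ^ 2)) + (1 - p) * (b ^ 2 * Real.log (b ^ 2))
        - (p * a ^ 2 + (1 - p) * b ^ 2) * Real.log (p * a ^ 2 + (1 - p) * b ^ 2)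
      ≤ (a - b) ^ 2 / 2 := by
    intro a b ha hb
    rcases hb.eq_or_lt with hb0 | hbpos
    · rcases ha.eq_or_lt with ha0 | hapos
      · rw [← ha0, ← hb0]; simp
      · -- `b = 0 < a`: swap the roles (weight `1 − p`)
        have h := key (1 - p) (by linarith) (by linarith) 0 a le_rfl hapos
        rw [← hb0]
        have e : (a - 0) ^ 2 / 2 = (0 - a) ^ 2 / 2 := by ring
        rw [e]
        refine le_of_eq_of_le ?_ h
        ring
    · exact key p hp0 hp1 a b ha hbpos
  have h := habs |a| |b| (abs_nonneg a) (abs_nonneg b)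
  rw [sq_abs, sq_abs] at h
  refine h.trans ?_
  have h2 : (|a| - |b|) ^ 2 ≤ (a - b) ^ 2 := by
    rw [← sq_abs (|a| - |b|), ← sq_abs (a - b)]
    exact pow_le_pow_left₀ (abs_nonneg _) (abs_abs_sub_abs_le_abs_sub a b) 2
  linarith

/-! ## The two-point space `ℤˣ = {±1}` in the tree's vocabulary -/

/-- `Σ_{u ∈ ℤˣ} f(u) = f(1) + f(−1)`. [folklore] -/
private theorem sum_units_int_aux (f : ℤˣ → ℝ) : ∑ u, f u = f 1 + f (-1) := by
  have : (univ : Finset ℤˣ) = {1, -1} := by decide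
  rw [this, Finset.sum_pair (by decide)]

/-- The entropy functional of a two-point law: `𝓛_π(g) = π₊g₊² log g₊² + π₋g₋² log g₋² − N log N`,
`N = π₊g₊² + π₋g₋²` (`π > 0` on `{±1}`; the conventions `0 log 0 = 0`, `log 0 = 0` agree on both sides).
[cite: Saloffcoste1997, §2.2.2 Example 2.2.1] -/
theorem entForm_units_int {π : ℤˣ → ℝ} (hπ : ∀ u, 0 < π u) (g : ℤˣ → ℝ) :
    entForm π g = π 1 * (g 1 ^ 2 * Real.log (g 1 ^ 2)) + π (-1) * (g (-1) ^ 2 * Real.log (g (-1) ^ 2))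
      - (π 1 * g 1 ^ 2 + π (-1) * g (-1) ^ 2) * Real.log (π 1 * g 1 ^ 2 + π (-1) * g (-1) ^ 2) := by
  unfold entForm piInner
  rw [sum_units_int_aux, sum_units_int_aux]
  have e : π 1 * (g 1 * g 1) + π (-1) * (g (-1) * g (-1)) = π 1 * g 1 ^ 2 + π (-1) * g (-1) ^ 2 := by ring
  rw [e]
  set N : ℝ := π 1 * g 1 ^ 2 + π (-1) * g (-1) ^ 2 with hN
  -- termwise `v log (v/N) = v log v − v log N` (also when `v = 0`; `v > 0 ⟹ N > 0`)
  have term : ∀ c v : ℝ, 0 < c → 0 ≤ v → c * v ≤ N →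
      v * Real.log (v / N) = v * Real.log v - v * Real.log N := by
    intro c v hc hv hle
    rcases hv.eq_or_lt with hv0 | hvpos
    · rw [← hv0]; simp
    · have hN0 : N ≠ 0 := ((mul_pos hc hvpos).trans_le hle).ne'
      rw [Real.log_div hvpos.ne' hN0]; ring
  have h1 : π 1 * g 1 ^ 2 ≤ N := by
    rw [hN]; nlinarith [hπ (-1), sq_nonneg (g (-1))]
  have h2 : π (-1) * g (-1) ^ 2 ≤ N := by
    rw [hN]; nlinarith [hπ 1, sq_nonneg (g 1)]
  rw [term _ _ (hπ 1) (sq_nonneg _) h1, term _ _ (hπ (-1)) (sq_nonneg _) h2]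
  ring

/-- The flip Dirichlet form of a two-point law: `𝓔_π(K_flip; g) = (g₊ − g₋)²/2` for the kernel
`K_flip(u,v) = 1{v = −u}` and `Σ π = 1` — [BBD]'s standard Dirichlet form `½(F(+1) − F(−1))²`.
[cite: BauerschmidtBodineauDagallier2023, §6.4.2 (standard Dirichlet form on `{±1}`)] -/
theorem dirichletForm_units_int_flip {π : ℤˣ → ℝ} (hπ1 : ∑ u, π u = 1) (g : ℤˣ → ℝ) :
    dirichletForm π (fun u v : ℤˣ => if v = -u then (1 : ℝ) else 0) g = (g 1 - g (-1)) ^ 2 / 2 := by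
  unfold dirichletForm
  rw [sum_units_int_aux, sum_units_int_aux, sum_units_int_aux]
  rw [sum_units_int_aux] at hπ1
  have h1 : ¬ ((1 : ℤˣ) = -1) := by decide
  have h1' : ¬ ((-1 : ℤˣ) = 1) := by decide
  simp [h1, h1']
  linear_combination ((g 1 - g (-1)) ^ 2 / 2) * hπ1

/-- **Log-Sobolev constant `α ≥ 1` for the flip kernel on `{±1}`, uniformly in the law**: for every
positive probability vector `π` on `ℤˣ` and every `g`, `𝓛_π(g) ≤ 𝓔_π(K_flip; g)` ([BBD] Prop. 15:
"the log-Sobolev constant with respect to the standard Dirichlet form on `{±1}` is at least `2`", in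
Saloff-Coste's normalisation of `LogSobolevConstant.lean`).
[cite: BauerschmidtBodineauDagallier2023, §6.4.2 Prop. 15] -/
theorem entForm_le_dirichletForm_twoPoint {π : ℤˣ → ℝ} (hπ : ∀ u, 0 < π u) (hπ1 : ∑ u, π u = 1)
    (g : ℤˣ → ℝ) :
    entForm π g ≤ dirichletForm π (fun u v : ℤˣ => if v = -u then (1 : ℝ) else 0) g := by
  rw [entForm_units_int hπ, dirichletForm_units_int_flip hπ1]
  have hp1 : π (-1) = 1 - π 1 := by rw [sum_units_int_aux] at hπ1; linarith
  rw [hp1]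
  exact twoPointAsym_entropy_le (hπ 1) (by have := hπ (-1); linarith) (g 1) (g (-1))

/-! ## Product Bernoulli measures on `{±1}^d` with the single-spin-flip Dirichlet form -/

/-- On `{±1}^d` the product chain `P̃ = Σ_j 1·K̃_flip,j` of Levin–Peres–Wilmer (12.22) (unit weights,
every coordinate kernel the flip `1{v = −u}`) is the single-spin-flip incidence matrix
`SpectralIsing.flipKernel` (`K(σ,σ′) = #{x : σ′ = σ^x}`). [cite: LevinPeres2017, §12.4 eq. (12.22)] -/
theorem prodKernel_one_flip_eq_flipKernel (d : ℕ) :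
    prodKernel (X := fun _ : Fin d => ℤˣ) (fun _ => (1 : ℝ))
        (fun _ (u v : ℤˣ) => if v = -u then (1 : ℝ) else 0)
      = SpectralIsing.flipKernel (Λ := Fin d) := by
  ext σ τ
  rw [prodKernel_apply]
  unfold SpectralIsing.flipKernel
  refine sum_congr rfl fun j _ => ?_
  rw [one_mul]
  simp only [coordKernel, SpectralIsing.flip]
  by_cases h : τ = Function.update σ j (-σ j)
  · have hj : τ j = -σ j := by rw [h, Function.update_self]
    have h2 : τ = Function.update σ j (τ j) := by rw [hj]; exact h
    rw [if_pos h2, if_pos hj, if_pos h]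
  · rw [if_neg h]
    by_cases h' : τ = Function.update σ j (τ j)
    · rw [if_pos h', if_neg]
      intro hj
      rw [hj] at h'
      exact h h'
    · rw [if_neg h']

/-- `Ent_π(F) = 𝓛_π(√F)` for `F ≥ 0` and `π > 0`: the entropy of [BBD] §2.1 (`SpectralIsing.ent`) is
Saloff-Coste's functional `𝓛` at `√F`. [cite: BauerschmidtBodineauDagallier2023, §2.1] -/
theorem SpectralIsing.ent_eq_entForm_sqrt {Λ : Type*} [Fintype Λ] [DecidableEq Λ]
    {π : (Λ → ℤˣ) → ℝ} (hπ : ∀ σ, 0 < π σ) {F : (Λ → ℤˣ) → ℝ} (hF : ∀ σ, 0 ≤ F σ) :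
    SpectralIsing.ent π F = entForm π (fun σ => Real.sqrt (F σ)) := by
  unfold SpectralIsing.ent entForm piInner
  simp_rw [Real.mul_self_sqrt (hF _), Real.sq_sqrt (hF _)]
  set N : ℝ := ∑ σ, π σ * F σ with hN
  have term : ∀ σ, π σ * (F σ * Real.log (F σ / N)) = π σ * (F σ * Real.log (F σ)) - π σ * F σ * Real.log N := by
    intro σ
    rcases (hF σ).eq_or_lt with h0 | hpos
    · rw [← h0]; simp
    · have hle : π σ * F σ ≤ N := by
        rw [hN]
        exact single_le_sum (f := fun τ => π τ * F τ) (fun τ _ => mul_nonneg (hπ τ).le (hF τ)) (mem_univ σ)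
      have hN0 : N ≠ 0 := ((mul_pos (hπ σ) hpos).trans_le hle).ne'
      rw [Real.log_div hpos.ne' hN0]; ring
  simp_rw [term]
  rw [sum_sub_distrib, ← sum_mul]

/-- **The product (infinite-temperature) Ising log-Sobolev inequality with `γ₀ = 2`, uniform in the
fields**: for positive probability vectors `π_j` on `{±1}` (`j < d`), their product `⊗_j π_j` on `{±1}^d`
and every `F ≥ 0`, `Ent_{⊗π}(F) ≤ D_{⊗π}(√F)` with the standard single-flip Dirichlet form
`D_m(G) = ½ Σ_x E_m[(G(σ) − G(σ^x))²]` (= `dirichletForm m flipKernel G`, `dirichletForm_flipKernel`) —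
[BBD] §6.4.3: "Since `μ_0^φ` is a product measure … one can take `γ₀ = 2`", by Prop. 15 and the
tensorisation Lemma 2.2.11 (`logSobolev_prodKernel_of_forall`).
[cite: BauerschmidtBodineauDagallier2023, §6.4.3 (p0039 L17–25) with §6.4.2 Prop. 15] -/
theorem SpectralIsing.ent_tensorFun_le_dirichletForm_flipKernel {d : ℕ} (π : Fin d → ℤˣ → ℝ)
    (hπ : ∀ j u, 0 < π j u) (hπ1 : ∀ j, ∑ u, π j u = 1) {F : (Fin d → ℤˣ) → ℝ} (hF : ∀ σ, 0 ≤ F σ) :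
    SpectralIsing.ent (tensorFun π) F
      ≤ dirichletForm (tensorFun π) SpectralIsing.flipKernel (fun σ => Real.sqrt (F σ)) := by
  rw [SpectralIsing.ent_eq_entForm_sqrt (tensorFun_pos hπ) hF, ← prodKernel_one_flip_eq_flipKernel]
  have h := logSobolev_prodKernel_of_forall d (fun _ => ℤˣ) π
    (fun _ (u v : ℤˣ) => if v = -u then (1 : ℝ) else 0) (fun _ => 1) 1 hπ hπ1
    (fun _ u v => by split_ifs <;> norm_num) (fun _ => zero_le_one)
    (fun j g => by
      rw [one_mul, one_mul]
      exact entForm_le_dirichletForm_twoPoint (hπ j) (hπ1 j) g)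
    (fun σ => Real.sqrt (F σ))
  rwa [one_mul] at h

end Literature.Probability.MarkovChains
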